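import Summits.AtomisticToContinuum.Crystallization.Theorems.ReggeStarCoercivityDefectFreeCrystallizesPalmDefs
import Summits.AtomisticToContinuum.Crystallization.Theorems.PalmUnimodularRigidityShellsToBarlowChartCubicGrowthAngle
import Summits.AtomisticToContinuum.Crystallization.Theorems.ShellsToBarlowChart.Negative.Tolerance
import Literature.Geometry.DiscreteGeometry.KissingPatterns

/-!
# Covering radius `< 1` of every-point-`SetGood` sets (stub D of line `palm-good-law`, crux stmt-AtomisticToContinuum-13603)

Stub `stub_funnelCovering` of the lead-c2 skeleton `Cruxes/DefectFreeCrystallizes/Lines/palm_good_law.lean`: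
if every point of `S ⊆ ℝ³` is `SetGood` in `S` (`Theorems.PalmGoodLaw.SetGood`: the other points of `S` in the OPEN ball of
radius `6/5`, recentred and rescaled by `a⁻¹` for some `a ∈ [9/10, 11/10]`, are `1/20`-matched after a linear isometry to the
FCC or HCP kissing pattern) and `S` is non-empty, then every point of space is within distance `< 1` of `S`.
Template: `Theorems/PalmUnimodularRigidityShellsToBarlowChartCubicGrowth.lean` (`shellAt`, `exists_step`, `step_cover`,
`exists_near_aux`, `exists_near`) for the `1 %`-good class; covering angles `fcc_coveringAngle`, `hcp_coveringAngle`
(`…CubicGrowthAngle`), `sqrt_two_lt'` (`ShellsToBarlowChart/Negative/Tolerance`).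

Proof.  SHELL FACT (`shellDir`): at a `SetGood` point `x` with scale `a`, every pattern point `v` (after the isometry `A`)
is `1/20`-close to a rescaled shell point `t = a⁻¹ • (z - x)`, `z ∈ S`; hence `‖z - x‖ = a‖t‖ ≤ 21a/20`, and by the `45°`
covering angle of both patterns, for every direction `d` some such `z` has `⟪z − x, d⟫ ≥ (0.707 − 0.05)·a·‖d‖`.
GREEDY STEP (`exists_step`): towards a target `p` at distance `r` this `z` has
`dist(z, p)² ≤ 1.1025 a² − 1.314 a r + r² ≤ r² − 1/10` once `r ≥ 1` (`step_cover`, `a ∈ [9/10, 11/10]`); inducting on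
`⌈10 · dist(x, p)²⌉₊` (`exists_near_aux`) reaches a point of `S` within distance `< 1` of `p`.
-/

noncomputable section

namespace Summit.AtomisticToContinuum.Crystallization.Theorems.PalmGoodLaw.FunnelCovering

open Literature.Geometry.DiscreteGeometry Literature.MathematicalPhysics.StatisticalMechanics
open Summit.AtomisticToContinuum.Crystallization.Theorems.PalmUnimodularRigidityShellsToBarlowChart
  (fcc_coveringAngle hcp_coveringAngle)
open Summit.AtomisticToContinuum.Crystallization.Theorems.ShellsToBarlowChartNegative (sqrt_two_lt')
open Metric

/-! ## Shell facts -/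

/-- **Directional shell fact at a `SetGood` point.**  If `x` is `SetGood` in `S` at scale
`a ∈ [9/10, 11/10]`, then for every vector `d` some `z ∈ S` has `‖z − x‖ ≤ 21a/20` and
`⟪z − x, d⟫ ≥ 0.657·a·‖d‖` (the `45°` covering angle of the FCC / HCP pattern, up to the `1/20`
matching error of the rescaled shell). [folklore] -/
theorem shellDir {S : Set (EuclideanSpace ℝ (Fin 3))} {x : EuclideanSpace ℝ (Fin 3)}
    (h : SetGood S x) :
    ∃ a : ℝ, 9 / 10 ≤ a ∧ a ≤ 11 / 10 ∧
      ∀ d : EuclideanSpace ℝ (Fin 3), ∃ z ∈ S,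
        ‖z - x‖ ≤ 21 / 20 * a ∧ 657 / 1000 * a * ‖d‖ ≤ inner ℝ (z - x) d := by
  obtain ⟨a, ha9, ha11, T, hT, hclose⟩ := h
  -- uniformise the two patterns: unit vectors with covering angle `45°`
  obtain ⟨P, hP1, hPcov, A, e, he⟩ : ∃ P : Finset (EuclideanSpace ℝ (Fin 3)),
      (∀ v ∈ P, ‖v‖ = 1) ∧
      (∀ u : EuclideanSpace ℝ (Fin 3), ∃ v ∈ P, ‖u‖ ≤ Real.sqrt 2 * inner ℝ u v) ∧
      ∃ A : EuclideanSpace ℝ (Fin 3) →ₗᵢ[ℝ] EuclideanSpace ℝ (Fin 3), ∃ e : ↥T ≃ ↥(P.image A),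
        ∀ t : ↥T, dist (t : EuclideanSpace ℝ (Fin 3)) (e t) ≤ 1 / 20 := by
    rcases hclose with ⟨A, e, he⟩ | ⟨A, e, he⟩
    · exact ⟨fccKissingPattern, fun v hv => norm_eq_one_of_mem_fccKissingPattern hv,
        fcc_coveringAngle, A, e, he⟩
    · exact ⟨hcpKissingPattern, fun v hv => norm_eq_one_of_mem_hcpKissingPattern hv,
        hcp_coveringAngle, A, e, he⟩
  have ha0 : 0 < a := by linarith
  -- every shell point is `a⁻¹ • (z - x)` for some `z ∈ S`
  have hTmem : ∀ t ∈ T, ∃ z ∈ S, z - x = a • t := by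
    intro t ht
    have ht' : t ∈ (↑T : Set (EuclideanSpace ℝ (Fin 3))) := ht
    rw [hT] at ht'
    obtain ⟨z, ⟨hz, -, -⟩, rfl⟩ := ht'
    exact ⟨z, hz, by rw [smul_smul, mul_inv_cancel₀ ha0.ne', one_smul]⟩
  refine ⟨a, ha9, ha11, fun d => ?_⟩
  -- a preimage direction `d'` with `A d' = d`
  obtain ⟨d', hd'⟩ : ∃ d' : EuclideanSpace ℝ (Fin 3), A d' = d :=
    ⟨(A.toLinearIsometryEquiv rfl).symm d, by
      rw [← LinearIsometry.coe_toLinearIsometryEquiv A rfl]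
      exact (A.toLinearIsometryEquiv rfl).apply_symm_apply d⟩
  have hnd : ‖d'‖ = ‖d‖ := by rw [← hd', LinearIsometry.norm_map]
  obtain ⟨v, hv, hcov⟩ := hPcov d'
  have hq : A v ∈ P.image A := Finset.mem_image_of_mem _ hv
  obtain ⟨t, ht⟩ : ∃ t : ↥T, e t = ⟨A v, hq⟩ := ⟨e.symm _, e.apply_symm_apply _⟩
  obtain ⟨z, hz, hzt⟩ := hTmem t.1 t.2
  -- the matching error and the ideal point
  have h1 : ‖t.1 - A v‖ ≤ 1 / 20 := by
    have := he t
    rwa [ht, dist_eq_norm] at this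
  have hAv : ‖A v‖ = 1 := by rw [LinearIsometry.norm_map, hP1 v hv]
  refine ⟨z, hz, ?_, ?_⟩
  · -- `‖z - x‖ = a‖t‖ ≤ a (1 + 1/20)`
    rw [hzt, norm_smul, Real.norm_of_nonneg ha0.le]
    have htri := abs_norm_sub_norm_le t.1 (A v)
    rw [hAv, abs_le] at htri
    have hnt : ‖t.1‖ ≤ 21 / 20 := by linarith [htri.2]
    linarith [mul_le_mul_of_nonneg_left hnt ha0.le]
  · -- `⟪z - x, d⟫ = a ⟪t, d⟫ ≥ a (0.707 - 0.05) ‖d‖`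
    have hinner : inner ℝ (A v) d = inner ℝ d' v := by
      rw [← hd', LinearIsometry.inner_map_map, real_inner_comm]
    have hI0 : 0 ≤ inner ℝ d' v :=
      (mul_nonneg_iff_of_pos_left (by positivity)).1 ((norm_nonneg d').trans hcov)
    have hI : 707 / 1000 * ‖d‖ ≤ inner ℝ d' v := by
      have h2 : ‖d'‖ ≤ 14143 / 10000 * inner ℝ d' v :=
        hcov.trans (mul_le_mul_of_nonneg_right sqrt_two_lt'.le hI0)
      rw [hnd] at h2
      linarith
    have herr : |inner ℝ (t.1 - A v) d| ≤ 1 / 20 * ‖d‖ :=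
      (abs_real_inner_le_norm _ _).trans (mul_le_mul_of_nonneg_right h1 (norm_nonneg _))
    have hsplit : inner ℝ t.1 d = inner ℝ (A v) d + inner ℝ (t.1 - A v) d := by
      rw [inner_sub_left]; ring
    have ht657 : 657 / 1000 * ‖d‖ ≤ inner ℝ t.1 d := by
      rw [hsplit, hinner]
      rw [abs_le] at herr
      linarith [herr.1]
    rw [hzt, real_inner_smul_left]
    linarith [mul_le_mul_of_nonneg_left ht657 ha0.le]

/-! ## Greedy steps -/

/-- **The greedy step.**  From a `SetGood` point `x ∈ S` towards any target `p` there is `z ∈ S`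
with `dist(z, p)² ≤ dist(x, p)² − 1.314·a·dist(x, p) + 1.1025·a²` for the scale
`a ∈ [9/10, 11/10]` of `x`. [folklore] -/
theorem exists_step {S : Set (EuclideanSpace ℝ (Fin 3))} {x : EuclideanSpace ℝ (Fin 3)}
    (h : SetGood S x) (p : EuclideanSpace ℝ (Fin 3)) :
    ∃ z ∈ S, ∃ a : ℝ, 9 / 10 ≤ a ∧ a ≤ 11 / 10 ∧
      dist z p ^ 2 ≤ dist x p ^ 2 - 1314 / 1000 * a * dist x p + 11025 / 10000 * a ^ 2 := by
  obtain ⟨a, ha9, ha11, hdir⟩ := shellDir h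
  obtain ⟨z, hz, hnorm, hinner⟩ := hdir (p - x)
  refine ⟨z, hz, a, ha9, ha11, ?_⟩
  have key : dist z p ^ 2 = ‖z - x‖ ^ 2 - 2 * inner ℝ (z - x) (p - x) + ‖p - x‖ ^ 2 := by
    rw [dist_eq_norm, ← norm_sub_sq_real, sub_sub_sub_cancel_right]
  have h2 : ‖p - x‖ = dist x p := by rw [dist_comm, dist_eq_norm]
  rw [key, h2]
  rw [h2] at hinner
  have ha0 : 0 ≤ a := by linarith
  nlinarith [mul_le_mul hnorm hnorm (norm_nonneg _) (by positivity), norm_nonneg (z - x)]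

/-- At distance `≥ 1` from the target a greedy step decreases the squared distance by `1/10`.
[folklore] -/
theorem step_cover {r a : ℝ} (ha9 : 9 / 10 ≤ a) (ha11 : a ≤ 11 / 10) (hr : 1 ≤ r) :
    r ^ 2 - 1314 / 1000 * a * r + 11025 / 10000 * a ^ 2 ≤ r ^ 2 - 1 / 10 := by
  nlinarith [mul_nonneg (sub_nonneg.2 hr) (sub_nonneg.2 ha9),
    mul_nonneg (sub_nonneg.2 ha9) (sub_nonneg.2 ha11)]

/-- **Covering radius `< 1`** (greedy descent of the squared distance by `1/10` per step).
[folklore] -/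
theorem exists_near_aux {S : Set (EuclideanSpace ℝ (Fin 3))} (hS : ∀ y ∈ S, SetGood S y)
    (p : EuclideanSpace ℝ (Fin 3)) :
    ∀ m : ℕ, ∀ c ∈ S, dist c p ^ 2 ≤ (m : ℝ) / 10 → ∃ y ∈ S, dist y p < 1 := by
  intro m
  induction m with
  | zero =>
    intro c hc hd
    refine ⟨c, hc, ?_⟩
    have : dist c p ^ 2 ≤ 0 := by simpa using hd
    nlinarith [dist_nonneg (x := c) (y := p)]
  | succ m ih =>
    intro c hc hd
    by_cases hlt : dist c p < 1
    · exact ⟨c, hc, hlt⟩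
    push Not at hlt
    obtain ⟨y, hy, a, ha9, ha11, hest⟩ := exists_step (hS c hc) p
    have := step_cover ha9 ha11 hlt
    refine ih y hy ?_
    push_cast at hd
    linarith

/-- **Stub `stub_funnelCovering` (D) of line `palm-good-law`.**  Every point of space is within distance `< 1` of a non-empty
set all of whose points are `SetGood`. [folklore] -/
theorem stub_funnelCovering :
    ∀ S : Set (EuclideanSpace ℝ (Fin 3)), (∀ y ∈ S, SetGood S y) →
      ∀ x ∈ S, ∀ p : EuclideanSpace ℝ (Fin 3), ∃ y ∈ S, dist y p < 1 := by
  intro S hS x hx p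
  exact exists_near_aux hS p ⌈10 * dist x p ^ 2⌉₊ x hx
    (by have := Nat.le_ceil (10 * dist x p ^ 2); linarith)

end Summit.AtomisticToContinuum.Crystallization.Theorems.PalmGoodLaw.FunnelCovering

end
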